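import Summits.NavierStokesRegularity.FluidComputer.PalasekTowerRegister

/-!
# The core ledger's loop class admits multiply-wound loops: winding multiplies circulation

Cell `ns-blowup`, seat `ns-blowup-refuter4` (g2; LEDGER REFUTER of the route `PalasekTowerBreakdown`,
items stmt-NavierStokesRegularity-19249 `HeredityAtOne`, 19250 `HeredityFromTwo`, 19178
`EpisodeInduction`, 19179 `EpisodeBase`). NEGATIVE-LANE slack lemma (K57-W, «WINDING LEVER»): a
register-hygiene fact about the HYPOTHESIS CLASS of the heredity items, not a refutation of any item.
LABEL: E–C typing (KERNEL bookkeeping; one-variable calculus). WHAT THIS IS NOT: not Navier–Stokes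
evidence — no flow, stage or tower is constructed; nothing here asserts regularity or blow-up.

The CORE LEDGER clause of the register (`CoreLedger R S k u`, `PalasekTowerRegister.lean`) asks, at each
recorded level `j ≤ k`, for a closed `C¹` loop `γ : [0,1] → ℝ³` with image in a ball of radius `1/N_j`,
parametric speed `‖γ'‖ ≤ 8π/N_j`, and `c₁ N_j^{β-2} ≤ ∮_γ u(τ_j)·dℓ`. The class pins NEITHER the winding
number NOR injectivity of `γ`. Consequences, typed below:

* `circulation_comp_natMul` — traversing a `1`-periodic loop `m` times multiplies the circulation
  of EVERY field by `m`: `∮_{γ(m·)} v = m ∮_γ v` [folklore];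
* `periodic_natMul`, `norm_deriv_natMul_le`, `contDiff_natMul` — the `m`-fold traversal of a loop of
  speed `≤ 8π/(m N_j)` inside the ball is again in the level-`j` class (speed `≤ 8π/N_j`);
* **`coreLoop_of_winding`** — hence the level-`j` ledger clause `c₁ N_j^{β-2} ≤ ∮ u·dℓ` is met by
  ANY periodic `C¹` loop in the ball of speed `≤ 8π/(m N_j)` carrying only `c₁ N_j^{β-2} / m` of TRUE
  (once-around) circulation. A round circle of radius `r` traversed once on `[0,1]` has speed `2πr`,
  so radius `1/N_j` admits `m = 4` and radius `1/(n N_j)` admits `m = 4n`: the ledger floor is a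
  floor on `sup_{a ≤ 1/N_j} (4/(a N_j)) · Flux(ω, disc of radius a)`, i.e. on vorticity AMPLITUDE
  `≳ c₁ A_j/(4π)` over some sub-ball, NOT on circulation — thin filaments of true circulation
  `≍ c₁ a Y_j / 4 → 0` (`a → 0`) pass it. The companion CAP `|∮| ≤ 8π c₂ N_j^{β-2}` of
  `PalasekTowerRegisterGlobalCoreFloors.lean` (speed × length) is winding-blind for the same reason.

REPAIR (planner's call, recorded not proposed): pin winding one — e.g. require `γ` injective on
`[0,1)`, or fix `γ` to a round circle of radius in `[1/(2N_j), 1/N_j]` (then `∮ = ` vorticity flux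
through its disc by Stokes), or state the clause as a flux `∫_D ω·n ≥ c₁ N_j^{β-2}` over a disc of
radius `1/N_j`.

References: A. J. Majda, A. L. Bertozzi, *Vorticity and Incompressible Flow* (CUP 2002), §1.6–§1.7,
Prop. 1.11, eq. (1.57) (circulation of a closed curve) [cite: MajdaBertozziCUP2002, §1.7];
S. Palasek, arXiv:2605.13827 §3.1 (core loops of the tower) [cite: Palasek2026ElementaryModel, §3.1].
-/

noncomputable section

namespace Summit.NavierStokesRegularity.CoreLedgerWinding

open Real Set Function MeasureTheory intervalIntegral Metric
open scoped RealInnerProductSpace ContDiff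

open Literature.Analysis.FluidPDE
open Summit.NavierStokesRegularity.FluidComputer.PalasekTowerClayBridge

section General

/-- The `m`-fold traversal `s ↦ γ (m s)` of a `1`-periodic loop is `1`-periodic. [folklore] -/
theorem periodic_natMul {X : Type*} {γ : ℝ → X} (hγ : Periodic γ 1) (m : ℕ) :
    Periodic (fun s => γ (m * s)) 1 := by
  intro s
  have h := hγ.nat_mul m (m * s)
  simpa [mul_add] using h

variable {E : Type*} [NormedAddCommGroup E] [InnerProductSpace ℝ E]

/-- The `m`-fold traversal of a `C¹` loop is `C¹`. [folklore] -/
theorem contDiff_natMul {γ : ℝ → E} (hγ : ContDiff ℝ 1 γ) (m : ℕ) :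
    ContDiff ℝ 1 (fun s => γ (m * s)) :=
  hγ.comp (contDiff_const.mul contDiff_id)

/-- The derivative of a `1`-periodic function is `1`-periodic. [folklore] -/
theorem periodic_deriv {γ : ℝ → E} (hγ : Periodic γ 1) : Periodic (deriv γ) 1 := by
  intro s
  have h : (fun x => γ (x + 1)) = γ := funext hγ
  rw [← deriv_comp_add_const, h]

/-- Speed of the `m`-fold traversal: `‖(γ(m·))'(s)‖ = m ‖γ'(m s)‖`; in particular a loop of speed
`≤ L / m` traversed `m` times has speed `≤ L`. [folklore] -/
theorem norm_deriv_natMul_le {γ : ℝ → E} {L : ℝ} {m : ℕ} (hm : 0 < m)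
    (hspeed : ∀ s, ‖deriv γ s‖ ≤ L / m) (s : ℝ) :
    ‖deriv (fun s => γ (m * s)) s‖ ≤ L := by
  have hd : deriv (fun s => γ ((m : ℝ) * s)) s = (m : ℝ) • deriv γ (m * s) :=
    deriv_comp_mul_left (m : ℝ) γ s
  have hm' : (0 : ℝ) < m := by exact_mod_cast hm
  rw [hd, norm_smul, Real.norm_natCast]
  calc (m : ℝ) * ‖deriv γ (m * s)‖ ≤ m * (L / m) := by gcongr; exact hspeed _
    _ = L := by field_simp

/-- **Winding multiplies circulation**: for a `1`-periodic loop `γ` whose circulation integrand is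
interval-integrable (e.g. `γ ∈ C¹`, `v` continuous), the `m`-fold traversal `s ↦ γ (m s)` has
`∮ v·dℓ = m · ∮_γ v·dℓ` — for EVERY field `v`. (Majda–Bertozzi (1.57); substitution `σ = m s` and
periodicity.) [cite: MajdaBertozziCUP2002, §1.7] -/
theorem circulation_comp_natMul (v : E → E) {γ : ℝ → E} (hγ : Periodic γ 1)
    (hint : ∀ a b, IntervalIntegrable (fun s => ⟪v (γ s), deriv γ s⟫) volume a b) (m : ℕ) :
    circulation v (fun s => γ (m * s)) = m * circulation v γ := by
  unfold circulation
  have hd : ∀ s, deriv (fun s => γ ((m : ℝ) * s)) s = (m : ℝ) • deriv γ (m * s) :=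
    fun s => deriv_comp_mul_left (m : ℝ) γ s
  simp_rw [hd, real_inner_smul_right]
  rw [intervalIntegral.integral_const_mul]
  have h2 := intervalIntegral.mul_integral_comp_mul_left (a := (0 : ℝ)) (b := 1)
    (f := fun y => ⟪v (γ y), deriv γ y⟫) (m : ℝ)
  rw [h2, mul_zero, mul_one]
  have hg : Periodic (fun s => ⟪v (γ s), deriv γ s⟫) 1 := fun s => by
    simp only [hγ s, periodic_deriv hγ s]
  have h := hg.intervalIntegral_add_zsmul_eq (m : ℤ) 0 hint
  simpa using h

end General

/-! ## The register's core-loop class -/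

/-- **The level-`j` core-ledger clause is met by `1/m` of the floor, wound `m` times.** If a
`1`-periodic `C¹` loop `γ` lies in the ball `B̄(x, 1/N_j)`, has speed `≤ 8π/(m N_j)`, and a continuous
field `w` has circulation `≥ c₁ N_j^{β-2} / m` around it (stated as `c₁ N_j^{β-2} ≤ m ∮_γ w`), then the
`m`-fold traversal of `γ` satisfies the level-`j` conjunct of `CoreLedger` verbatim: `C¹`, closed, in
the ball, speed `≤ 8π/N_j`, and `c₁ N_j^{β-2} ≤ ∮ w·dℓ`. (Register slack: the clause certifies
speed × length, not winding-one circulation.) [cite: Palasek2026ElementaryModel, §3.1] -/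
theorem coreLoop_of_winding {R : TowerRates} {S : Schedule R} {j : ℕ}
    {w : EuclideanSpace ℝ (Fin 3) → EuclideanSpace ℝ (Fin 3)} (hw : Continuous w)
    {x : EuclideanSpace ℝ (Fin 3)} {γ : ℝ → EuclideanSpace ℝ (Fin 3)} {m : ℕ} (hm : 0 < m)
    (hγ : ContDiff ℝ 1 γ)
    (hper : Periodic γ 1) (hball : ∀ s, γ s ∈ closedBall x (1 / R.N j))
    (hspeed : ∀ s, ‖deriv γ s‖ ≤ 8 * π / R.N j / m)
    (hΓ : S.c₁ * R.N j ^ (R.β - 2) ≤ m * circulation w γ) :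
    ∃ γ' : ℝ → EuclideanSpace ℝ (Fin 3), ContDiff ℝ 1 γ' ∧ γ' 0 = γ' 1 ∧
      (∀ s ∈ Icc (0 : ℝ) 1, γ' s ∈ closedBall x (1 / R.N j)) ∧
      (∀ s ∈ Icc (0 : ℝ) 1, ‖deriv γ' s‖ ≤ 8 * π / R.N j) ∧
      S.c₁ * R.N j ^ (R.β - 2) ≤ circulation w γ' := by
  refine ⟨fun s => γ (m * s), contDiff_natMul hγ m, ?_, fun s _ => hball _,
    fun s _ => norm_deriv_natMul_le hm hspeed s, ?_⟩
  · have := periodic_natMul hper m 0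
    simpa using this.symm
  · have hint : ∀ a b, IntervalIntegrable (fun s => ⟪w (γ s), deriv γ s⟫) volume a b :=
      fun a b => ((hw.comp hγ.continuous).inner (hγ.continuous_deriv le_rfl)).intervalIntegrable a b
    rwa [circulation_comp_natMul w hper hint m]

/-- **The same for the full `CoreLedger`**: a velocity record `u` whose level-`j` slices (`j ≤ k`) are
continuous and carry, around `1`-periodic `C¹` loops of speed `≤ 8π/(m_j N_j)` in balls `B̄(x_j, 1/N_j)`
with `‖x_j‖ ≤ radius`, circulation `≥ c₁ N_j^{β-2} / m_j`, satisfies `CoreLedger R S k u`.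
[cite: Palasek2026ElementaryModel, §3.1] -/
theorem coreLedger_of_winding {R : TowerRates} {S : Schedule R} {k : ℕ}
    {u : ℝ → EuclideanSpace ℝ (Fin 3) → EuclideanSpace ℝ (Fin 3)}
    (h : ∀ j, j ≤ k → Continuous (u (S.τ j)) ∧
      ∃ (x : EuclideanSpace ℝ (Fin 3)) (γ : ℝ → EuclideanSpace ℝ (Fin 3)) (m : ℕ), 0 < m ∧
      ‖x‖ ≤ S.radius ∧ ContDiff ℝ 1 γ ∧ Periodic γ 1 ∧ (∀ s, γ s ∈ closedBall x (1 / R.N j)) ∧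
      (∀ s, ‖deriv γ s‖ ≤ 8 * π / R.N j / m) ∧
      S.c₁ * R.N j ^ (R.β - 2) ≤ m * circulation (u (S.τ j)) γ) :
    CoreLedger R S k u := by
  intro j hj
  obtain ⟨hu, x, γ, m, hm, hx, hγ, hper, hball, hspeed, hΓ⟩ := h j hj
  obtain ⟨γ', h1, h2, h3, h4, h5⟩ := coreLoop_of_winding hu hm hγ hper hball hspeed hΓ
  exact ⟨x, γ', hx, h1, h2, h3, h4, h5⟩

end Summit.NavierStokesRegularity.CoreLedgerWinding

end
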